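import Summits.HodgeConjecture.HodgeConjecture.Theses.AnchorTransport
import Summits.HodgeConjecture.HodgeConjecture.Theorems.AnchorTransportIsoInvariance
import Literature.AlgebraicGeometry.HodgeTheory.ComplexConjugationHolds
import Literature.AlgebraicGeometry.HodgeTheory.FermatHypersurfaceReduction
import Literature.AlgebraicGeometry.Motives.CurveNet
import Literature.AlgebraicGeometry.Motives.VarietiesProperProofs

/-!
# Route AnchorTransport — the target `Target` is equivalent to the Hodge conjecture
(helpers for item stmt-HodgeConjecture-1079)

`Target = VariationalHodge ∧ AnchorExistence` (the two crux bodies inlined).  This file certifies,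
on the tree's real carriers, the planner's claim "X fails iff HC fails":

* `anchorTransport_variationalHodge_of_hodgeConjecture` — `HodgeConjecture → VariationalHodge`
  (apply HC on the fibre `𝒳_s`, smooth projective by `IsSmoothProjectiveFamily`);
* `anchorTransport_anchor_of_mem_algebraicClasses` — the CONSTANT-FAMILY anchor: an algebraic
  rational `(p,p)` class `c` on a smooth projective `X` is anchored by the family
  `X ⟶ Spec ℂ` (`Motives.toSpecOver X`), the point `𝟙 (Spec ℂ)`, the fibre iso
  `X ≅ X ×_{Spec ℂ} Spec ℂ` and `A = c` (the "trivially true when `c` is already algebraic" clause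
  of the `AnchorExistence` docstring), whence
  `anchorTransport_anchorExistence_of_hodgeConjecture : HodgeConjecture → AnchorExistence`;
* `anchorTransport_target_iff_hodgeConjecture : Target ↔ HodgeConjecture`, the forward direction
  being the route's deciding theorem `closes` fed with the proved support items `IsoInvariance`
  (`anchorTransport_isoInvariance_proof`) and `HodgeModels` (`nonempty_hodgeModel_holds`).

Consequently item 1079 is exactly as hard as the summit: it closes iff both cruxes
`VariationalHodge` (stmt-1076) and `AnchorExistence` (stmt-1077) close.
-/

noncomputable section

-- `Summit.HodgeConjecture.HodgeConjecture.Theorems` is the mandated namespace (single-problem summit: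
-- Problem = Summit), which `linter.dupNamespace` flags on every declaration; the lakefile turns the
-- linter off tree-wide (weak option), restated here so stand-alone elaboration is warning-free too.
set_option linter.dupNamespace false

open CategoryTheory AlgebraicGeometry CategoryTheory.Limits
open Literature.AlgebraicGeometry Literature.AlgebraicGeometry.Motives
  Literature.AlgebraicGeometry.HodgeTheory Literature.AlgebraicTopology.SingularHomology

namespace Summit.HodgeConjecture.HodgeConjecture.Theorems

/-- **`HodgeConjecture → VariationalHodge`** (Charles–Schnell Cor. 11.3.6 direction, trivial
form): every fibre `𝒳_s` of a smooth projective family is smooth projective of dimension `n`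
(`IsSmoothProjectiveFamily.isSmoothProjective`), and `A|_{𝒳_s}` is a rational `(p,p)` class by
hypothesis, so the Hodge conjecture on `𝒳_s` makes it algebraic; the base hypotheses and the
anchor are not used. [cite: CharlesSchnell2014Notes, Cor. 11.3.6] -/
theorem anchorTransport_variationalHodge_of_hodgeConjecture (h : _root_.HodgeConjecture) :
    Summit.HodgeConjecture.HodgeConjecture.Theses.AnchorTransport.VariationalHodge := by
  unfold Summit.HodgeConjecture.HodgeConjecture.Theses.AnchorTransport.VariationalHodge
  intro n 𝒳 S f hf _ _ p A hA _ s
  exact (h (hf.isSmoothProjective s)).2 p _ (hA s).1 (hA s).2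

section ConstantFamily

variable {n : ℕ} {X : SchemeOver ℂ}

/-- A `ℂ`-point of `Spec ℂ` (as a `ℂ`-scheme) has an isomorphism as underlying morphism: its
composite with the (iso) structure map of `specOver ℂ ℂ` is that structure map. [folklore] -/
theorem isIso_left_algPoints_specOver (s : AlgPoints (specOver ℂ ℂ) ℂ) : IsIso s.left := by
  haveI := CurveNet.isIso_specOver_self_hom ℂ
  haveI : IsIso (s.left ≫ (specOver ℂ ℂ).hom) := by
    rw [Over.w s]
    infer_instance
  exact IsIso.of_isIso_comp_right s.left (specOver ℂ ℂ).hom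

/-- For the constant family `X ⟶ Spec ℂ`, every fibre inclusion `X_s ⟶ X` is an isomorphism of
`ℂ`-schemes (pull-back of the iso `s : Spec ℂ ⟶ Spec ℂ`). [folklore] -/
theorem isIso_fiberι_toSpecOver (s : AlgPoints (specOver ℂ ℂ) ℂ) :
    IsIso (fiberι (toSpecOver X) s) := by
  haveI := isIso_left_algPoints_specOver s
  haveI : IsIso ((Over.forget _).map (fiberι (toSpecOver X) s)) := by
    change IsIso (pullback.fst (toSpecOver X).left s.left)
    infer_instance
  exact isIso_of_reflects_iso _ (Over.forget _)

/-- The constant family `X ⟶ Spec ℂ` of a smooth projective `X` of dimension `n` is a smooth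
projective family of relative dimension `n` (its fibres are isomorphic to `X`). [folklore] -/
theorem isSmoothProjectiveFamily_toSpecOver (hX : IsSmoothProjective n X) :
    IsSmoothProjectiveFamily (toSpecOver X) n where
  smoothOfRelativeDimension := hX.smoothOfRelativeDimension
  isProper := IsSmoothProjective.isProper_holds hX
  isSmoothProjective s :=
    haveI := isIso_fiberι_toSpecOver (X := X) s
    hX.of_iso (asIso (fiberι (toSpecOver X) s)).symm

/-- `Spec ℂ` is irreducible. [folklore] -/
theorem irreducibleSpace_specOver_left : IrreducibleSpace ↥(specOver ℂ ℂ).left :=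
  inferInstanceAs (IrreducibleSpace (PrimeSpectrum ℂ))

/-- The structure map of `Spec ℂ` over `ℂ` is smooth (it is an isomorphism). [folklore] -/
theorem smooth_specOver_hom : Smooth (specOver ℂ ℂ).hom := by
  haveI := CurveNet.isIso_specOver_self_hom ℂ
  infer_instance

/-- **The constant-family anchor.** If `c ∈ H²ᵖ(X(ℂ); ℂ)` is a rational `(p,p)` class on a smooth
projective `X` of dimension `n` which is ALREADY algebraic, then `(X, c)` is anchored in the sense of
`AnchorExistence`: take the constant family `X ⟶ Spec ℂ`, `s₁ = s₀ = 𝟙`, the fibre iso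
`X ≅ X ×_{Spec ℂ} Spec ℂ` and `A = c` (rationality, Hodge type and algebraicity transport along the
fibre isos: `IsRationalClass.pullback`, `IsOfHodgeType.map_of_iso`,
`mem_algebraicClasses_map_of_iso`). This is the clause "trivially true when `c` is already algebraic
(constant family)" of the item's docstring. [folklore] -/
theorem anchorTransport_anchor_of_mem_algebraicClasses (hX : IsSmoothProjective n X) (p : ℕ)
    (c : complexBetti X (2 * p)) (hc : IsRationalClass c) (hpp : IsOfHodgeType n X (2 * p) p p c)
    (halg : c ∈ algebraicClasses X p) :
    ∃ (𝒳 S : SchemeOver ℂ) (f : 𝒳 ⟶ S) (s₁ s₀ : ComplexPoints S) (e : X ≅ fiberOver f s₁)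
      (A : complexBetti 𝒳 (2 * p)),
      IsSmoothProjectiveFamily f n ∧ IrreducibleSpace S.left ∧ Smooth S.hom ∧
      (∀ s : ComplexPoints S, IsRationalClass (complexBetti.map (fiberι f s) (2 * p) A) ∧
        IsOfHodgeType n (fiberOver f s) (2 * p) p p (complexBetti.map (fiberι f s) (2 * p) A)) ∧
      complexBetti.map e.hom (2 * p) (complexBetti.map (fiberι f s₁) (2 * p) A) = c ∧
      complexBetti.map (fiberι f s₀) (2 * p) A ∈ algebraicClasses (fiberOver f s₀) p := by
  haveI : ∀ s : AlgPoints (specOver ℂ ℂ) ℂ, IsIso (fiberι (toSpecOver X) s) :=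
    isIso_fiberι_toSpecOver
  refine ⟨X, specOver ℂ ℂ, toSpecOver X, 𝟙 _, 𝟙 _, (asIso (fiberι (toSpecOver X) (𝟙 _))).symm, c,
    isSmoothProjectiveFamily_toSpecOver hX, irreducibleSpace_specOver_left, smooth_specOver_hom,
    fun s ↦ ⟨?_, ?_⟩, ?_, ?_⟩
  · exact hc.pullback _
  · exact IsOfHodgeType.map_of_iso (asIso (fiberι (toSpecOver X) s)) hpp
  · change (complexBetti.map (asIso (fiberι (toSpecOver X) (𝟙 _))).hom (2 * p) ≫
      complexBetti.map (asIso (fiberι (toSpecOver X) (𝟙 _))).inv (2 * p)) c = c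
    rw [← complexBetti.map_comp, Iso.inv_hom_id, complexBetti.map_id]
    rfl
  · exact mem_algebraicClasses_map_of_iso hX
      ((isSmoothProjectiveFamily_toSpecOver hX).isSmoothProjective _)
      (asIso (fiberι (toSpecOver X) _)) halg

end ConstantFamily

/-- **`HodgeConjecture → AnchorExistence`**: under HC every rational `(p,p)` class is algebraic,
hence anchored by the constant family (`anchorTransport_anchor_of_mem_algebraicClasses`).
[folklore] -/
theorem anchorTransport_anchorExistence_of_hodgeConjecture (h : _root_.HodgeConjecture) :
    Summit.HodgeConjecture.HodgeConjecture.Theses.AnchorTransport.AnchorExistence := by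
  unfold Summit.HodgeConjecture.HodgeConjecture.Theses.AnchorTransport.AnchorExistence
  intro n X hX p c hc hpp
  exact anchorTransport_anchor_of_mem_algebraicClasses hX p c hc hpp ((h hX).2 p c hc hpp)

/-- **`HodgeConjecture → Target`** (`Target` is the conjunction of the two crux bodies).
[folklore] -/
theorem anchorTransport_target_of_hodgeConjecture (h : _root_.HodgeConjecture) :
    Summit.HodgeConjecture.HodgeConjecture.Theses.AnchorTransport.Target :=
  ⟨anchorTransport_variationalHodge_of_hodgeConjecture h,
    anchorTransport_anchorExistence_of_hodgeConjecture h⟩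

/-- **`Target ↔ HodgeConjecture`**: the route's target (Grothendieck's variational Hodge
conjecture in global-class form ∧ anchor existence) is equivalent to the summit statement.
Forward: the route's deciding theorem `closes` with the proved support items `IsoInvariance`
(`anchorTransport_isoInvariance_proof`) and `HodgeModels` (`nonempty_hodgeModel_holds`);
backward: `anchorTransport_target_of_hodgeConjecture`. [folklore] -/
theorem anchorTransport_target_iff_hodgeConjecture :
    Summit.HodgeConjecture.HodgeConjecture.Theses.AnchorTransport.Target ↔ _root_.HodgeConjecture :=
  ⟨fun hT ↦ Summit.HodgeConjecture.HodgeConjecture.Theses.AnchorTransport.closes hT.1 hT.2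
      anchorTransport_isoInvariance_proof fun _ _ ↦ nonempty_hodgeModel_holds,
    anchorTransport_target_of_hodgeConjecture⟩

end Summit.HodgeConjecture.HodgeConjecture.Theorems

end
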